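import Summits.QuantumFields.YangMills.Theorems.UnitScaleTiltProp8FlatProp7LocalChart
import Summits.QuantumFields.YangMills.Theorems.UnitScaleTiltMinimiserStabilityRegPrProp8Iter
import HarnessLib

/-!
# Route `UnitScaleTilt`, crux K1 child «MinimiserStabilityRegPr» (stmt-QuantumFields-19200), registered stub V2′ `stub_halvingStep`
# (skeleton v7 cc37a17877262141) — **SECT. F's LAST MILE (167) ⇒ (168) ⇒ (2) AT THE `T³` CARRIER, BY NAME**:
# the registered one-step halving text follows from ONE located schema, «every minimiser over (6)(ε₀) admits, around every site of the
# finest torus, a LOCAL exponential chart `U^{u⁻¹} = e^{iηA}` with the (167)-bounds `¼max{B₃ε₁, ½ε₀} + Kε₀²`»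

Cell `ym3-torus` (HUMAN RULING D-0037, YM ladder rung R3 — continuum SU(2) YM₃ on the torus is a RUNG, not the Clay problem), width seat
`ym-ust-19200-w3` gen 0 (D-0149 / director l-ym3-bs R350 (A′); OWNER W-SEAT START LIST 2026-08-27T22:29:16Z: «w3 = `stub_halvingStep`»).
`--supports stmt-QuantumFields-19200 --as helper`; def-free, 0 sorry, standard axioms.  NOTHING of Bałaban's analysis is asserted: the local
charts are a HYPOTHESIS (the content of pillars P1 [B8] Thm 2 on the cube sequence, P2 flat operators (cor28 by name), P3 chart/current, P5 (158));
this file is the kernel-checked passage from their OUTPUT to the registered stub's conclusion.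

THE PRINT ([Balaban1985Variational] Sect. F p. 304): *«If M′ε₀ ≦ a₅, then we get |A|, |∇^ηA|, |∂^{η*}∂^ηA|, |Δ^ηA| < ¼M_Δmax{B₃ε₁, ½ε₀} + ⅛M′ε₀
on Δ. (167)  Now let us draw conclusions concerning the regularity of U′_k from the above inequality. We take Δ = Δ₀, hence M_Δ = 1, M′ = 1, and
we have this inequality with ε′ = ½max{B₃ε₁, ½ε₀} on the right-hand side. This and the inequality (1.54) of [6] imply |D^{η*}_{U₁}∂U₁| < ε′ +
86dε′² < 2ε′ on Δ₀ (168) for ε′ small, similarly for |∂U₁ − 1|. Again using the fact that U₁ is a gauge transformed U′_k on Δ₀, and that the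
conditions (2) are gauge invariant, we conclude that U′_k satisfies (2) on Δ₀ with max{B₃ε₁, ½ε₀} instead of ε₀. The cube Δ₀ is an arbitrary
cube Δ(y) = Bʲ(y), if y ∈ Λ_j, hence U_k belongs to the space (2) with max{B₃ε₁, ½ε₀} instead of ε₀.»*  ([6] = [Balaban1985RegularSpaces];
its (1.54)/(1.141)–(1.142)/Prop. 7 (1.144) at the flat background is pillar piece F2 `Prop7LocalChart.inSpace_of_local_chart_flat` (p523090),
lit-balaban p40's `ℤᵈ` theorem with the constants `3α₂`, `1/(80d)`.)

WHAT THIS FILE PROVES (all at the d = 3 carrier of `T3Thm1Carrier` / `T3Thm1CarrierNative`; `η = L^{−(K−n)}`, top scale `Lᵏη = 1`):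
* §1 `regPr_of_localCharts` — **(168) ⇒ (2), LOCAL-TO-GLOBAL**: if around EVERY site `x` of the finest torus there are a domain family `Ω ∋ x`
  (at the top level), a torus gauge transformation `u` and a bondwise self-adjoint one-form `A` such that `U^{u⁻¹} = e^{iηA}` on the bonds the
  class reads (F2's letters: `mgauge 1♯ (u♯)⁻¹ U♯ = cfgExp η A♯` on the `SideTouches` layers of `pullDom Ω j`) with [6] (1.140) at size `α₂`
  (`Cond140 … α₂ j (pullDom Ω j) 1♯ A♯`, `j ≤ k`), then `U ∈ 𝔘_k(α₀ + 3α₂)` = `RegPr F n K (α₀ + 3α₂) U` for every `0 < α₀ ≤ 1/240`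
  (`0 < α₂ ≤ 1/240`).  The charts are LOCAL on purpose: a global small `A` does not exist in general (holonomy around the torus).
  `regPr_of_localCharts_top` — the same with ONE set `S ∋ x` at the top level (family `topFam S`: `∅` below `k`), the shape Sect. F produces
  (`Δ₀ = Bᵏ(y)`).
* §2 `lastMile_arith` — the arithmetic of (167)–(168) with F2's constants: for `m = max{B₃ε₁, ½ε₀}`, `B₃ε₁ < ε₀ ≤ a₅`, `a₅ ≤ 1/90`,
  `24Ka₅ < 1`, `e₁ = ¼m + Kε₀²`: `α₀ := m − 3e₁ > 0`, `α₀, e₁ ≤ 1/240`, `α₀ + 3e₁ = m`.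
* §3 `halvingMinimisers_of_localCharts167` — **THE REGISTERED STUB'S MINIMISER FORM ⇐ THE (167)-CHART SCHEMA**: if every minimiser `U` of the
  Wilson action over print's space (6)(ε₀) (`regFibrePr`, `0 < ε₀ ≤ a`, over a (7)-datum `V` with `0 < ε₁`, in the regime `B₃ε₁ < ε₀`) admits
  around every site a local chart as in §1 with `α₂ = ¼max{B₃ε₁, ½ε₀} + Kε₀²` (print's (167) on `Δ₀`, `M_Δ = M′ = 1`, with the second-order
  constant `K = B₀(C₄ + 4C₂)(36dL²B₁R₁M₁)²` of (165) kept as a letter), then every such minimiser lies in `𝔘_k(max{B₃ε₁, ½ε₀})` for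
  `ε₀ ≤ a₅`, ANY `a₅ ≤ min{a, 1/90}` with `24Ka₅ < 1` (the regime `ε₀ ≤ B₃ε₁` is the monotonicity of (2), `regPr_mono`);
  `halvingLiteral_of_localCharts167` — the LITERAL body of v7's `stub_halvingStep` at `(L, B₃, a₅)` (through p1 g14's
  `Prop8Iter.halvingLiteral_of_minimisers`); `exists_a5` — an admissible `a₅ > 0` exists for every `K ≥ 0`, `a > 0`.
So after this file: `stub_halvingStep` ⇐ (∀ odd L > 1 ∃ B₃ > 4 ∃ K ≥ 0 ∃ a > 0, the (167)-chart schema at `(L, B₃, K, a)`) BY NAME — the socket the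
pillars feed (P1 gauge + P2/P3/P5 give exactly (167) on `Δ₀`, [Balaban1985Variational] (152)–(167)).
* §4 (v1.1, append-only) `stubText_of_localCharts167` — v7's `stub_halvingStep` FULL TEXT (`∀ L, 1 < L → ∃ B₃, 4 < B₃ ∧ ∃ a₅, 0 < a₅ ∧ …`) from the
  schema family; `prop8_of_localCharts167` — `Prop8Printed B₃ (famX L)` from the same (v7's `landed_prop8` line).

HONEST SCOPE: the schema is NOT proved here (it is Sect. F (144)–(167)); F2's constants replace print's `2ε′`/`86dε′²` by `3α₂` (so `¼` still
works: `¾ < 1`); `a₅` shrinks accordingly (print: «a largest absolute number a₅»).  No definition, no sorry, standard axioms.  NOT a claim about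
the crux, the rung, or the mass gap.

References: T. Bałaban, CMP **102** (1985) 277–309 [Balaban1985Variational] Sect. F (144)–(168) pp.300–304, (2)/(6) p.278, Prop. 8 p.304;
CMP **99** (1985) 75–102 [Balaban1985RegularSpaces] (1.140)–(1.144) p.100, (1.7)/(1.9) p.77.
-/

set_option autoImplicit false

noncomputable section

open scoped Matrix.Norms.L2Operator

namespace Summit.QuantumFields.YangMills.Theorems.Prop8LastMile

open Literature.MathematicalPhysics.QuantumFieldTheory.Balaban1983to89
open Literature.MathematicalPhysics.QuantumFieldTheory.Balaban1983to89.T3ContinuumYM3Torus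
open Literature.MathematicalPhysics.QuantumFieldTheory.Balaban1983to89.T3UnitLawDensityEML (ℰp)
open Literature.MathematicalPhysics.QuantumFieldTheory.Balaban1983to89.T3DescentFibreTower
open Literature.MathematicalPhysics.QuantumFieldTheory.Balaban1983to89.T3ConstrainedMinimiser
open Literature.MathematicalPhysics.QuantumFieldTheory.Balaban1983to89.T3RegularMinimiser
open Literature.MathematicalPhysics.QuantumFieldTheory.Balaban1983to89.T3PrintedRegularMinimiser
open Literature.MathematicalPhysics.QuantumFieldTheory.Balaban1983to89.T3PrintedMinimiserExistence
open Literature.MathematicalPhysics.QuantumFieldTheory.Balaban1983to89.T3Thm1Carrier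
open Literature.MathematicalPhysics.QuantumFieldTheory.Balaban1983to89.T3Thm1CarrierNative
open B7Eq92Concrete (mgauge)
open B8Eq140Level (SideTouches Cond140)
open B8Eq184Proof (cfgExp)
open B8Thm2SetupTorus (cfgPull gaugePull pullDom)
open B10Eq27TorusAxialLog (pull toUField unitsField)
open B10Eq68TorusRegularity (InSpace InSpaceA RegPlaqAt RegDivAt Touches BTouches touches_of_src_mem)

/-! ## §1 (168) ⇒ (2): local exponential charts with (1.140)-bounds around every site ⇒ the printed regular space -/

section LocalToGlobal

variable (F : T3Family) (n K : ℕ)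

/-- **(168) ⇒ (2), LOCAL-TO-GLOBAL** ([Balaban1985Variational] p. 304 «The cube Δ₀ is an arbitrary cube Δ(y) = Bʲ(y) … hence U_k belongs to the
space (2)»): if around every site `x` there is a local exponential chart with (1.140)-bounds `α₂` (flat background) on a domain family containing
`x` at the top level, then `U ∈ 𝔘_k(α₀ + 3α₂)` for every `0 < α₀ ≤ 1/240` — F2 `Prop7LocalChart.inSpace_of_local_chart_flat` chart by chart,
then the top-level clauses at `x` and the monotonicity of the thresholds in the level (`RegPlaqAt/RegDivAt.of_le_level`), read back through
`regPr_iff_inSpace`. [cite: Balaban1985Variational, (168) p.304; Balaban1985RegularSpaces, Prop. 7 (1.144) p.100] -/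
theorem regPr_of_localCharts {α₀ α₂ : ℝ} (hα₀ : 0 < α₀) (hα₀c : α₀ ≤ 1 / 240) (hα₂ : 0 < α₂) (hα₂c : α₂ ≤ 1 / 240)
    (U : GaugeField (F.P K) 0 (Matrix.specialUnitaryGroup (Fin 2) ℂ))
    (H : ∀ x : Site (F.P K) 0, ∃ (Ω : ℕ → Set (Site (F.P K) 0)) (u : GaugeTransf (F.P K) 0 (Matrix.unitaryGroup (Fin 2) ℂ))
        (A : GaugeField (F.P K) 0 (Matrix (Fin 2) (Fin 2) ℂ)),
        x ∈ Ω (K - n) ∧ (∀ b : PBond (F.P K) 0, IsSelfAdjoint (A b)) ∧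
        (∀ j, j ≤ K - n → ∀ (z : B7Prop1Explicit.Site (F.P K).d) (μ : Fin (F.P K).d), SideTouches (pullDom Ω j) z μ →
          mgauge (cfgPull (F.P K) 1) (gaugePull (F.P K) u)⁻¹ (cfgPull (F.P K) (toUField U)) z μ =
            cfgExp (((F.L : ℝ)⁻¹) ^ (K - n)) (pull A 0) z μ) ∧
        (∀ j, j ≤ K - n → Cond140 (F.P K).L (((F.L : ℝ)⁻¹) ^ (K - n)) α₂ j (pullDom Ω j) (cfgPull (F.P K) 1) (pull A 0))) :
    RegPr F n K (α₀ + 3 * α₂) U := by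
  have hL0 : (0 : ℝ) < (F.L : ℝ)⁻¹ := inv_pos.mpr (by exact_mod_cast lt_trans zero_lt_one F.hL.2)
  have hη : (0 : ℝ) < ((F.L : ℝ)⁻¹) ^ (K - n) := pow_pos hL0 _
  have hε : (0 : ℝ) ≤ α₀ + 3 * α₂ := by positivity
  have hd : (1 : ℝ) / 240 = 1 / (80 * (F.P K).d) := by rw [T3Family.P_d]; norm_num
  -- the local class memberships, site by site
  have hloc : ∀ x : Site (F.P K) 0, ∃ Ω : ℕ → Set (Site (F.P K) 0), x ∈ Ω (K - n) ∧
      InSpace (K - n) Ω (α₀ + 3 * α₂) (((F.L : ℝ)⁻¹) ^ (K - n)) (toUField U) := by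
    intro x
    obtain ⟨Ω, u, A, hx, hA, hchart, h140⟩ := H x
    exact ⟨Ω, hx, Prop7LocalChart.inSpace_of_local_chart_flat (K - n) hη hα₀ (hd ▸ hα₀c) hα₂ (hd ▸ hα₂c) Ω
      (toUField U) u A hA hchart h140⟩
  rw [regPr_iff_inSpace hε]
  -- the all-torus class: top level from the local charts, lower levels by monotonicity of the thresholds
  show InSpaceA (K - n) (fun _ => (Set.univ : Set (Site (F.P K) 0))) (α₀ + 3 * α₂) (((F.L : ℝ)⁻¹) ^ (K - n))
    (unitsField (toUField U))
  have htopP : RegPlaqAt (K - n) (Set.univ : Set (Site (F.P K) 0)) (α₀ + 3 * α₂) (unitsField (toUField U)) := by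
    intro q _
    obtain ⟨Ω, hx, hΩ⟩ := hloc q.src
    exact (hΩ (K - n) le_rfl).1 q (touches_of_src_mem hx)
  have htopD : RegDivAt (K - n) (Set.univ : Set (Site (F.P K) 0)) (α₀ + 3 * α₂) (((F.L : ℝ)⁻¹) ^ (K - n))
      (unitsField (toUField U)) := by
    intro b _
    obtain ⟨Ω, hx, hΩ⟩ := hloc b.src
    exact (hΩ (K - n) le_rfl).2 b (Or.inl hx)
  intro j hj
  exact ⟨htopP.of_le_level hj hε, htopD.of_le_level hj hε hη⟩

/-- **THE TOP-LEVEL FAMILY OF ONE SET** `S` (Sect. F's `Δ₀`): `∅` at the levels `j < k`, `S` at `j = k` (and above, harmlessly).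
Inline everywhere as `fun j => if K - n ≤ j then S else ∅`; the clauses of `𝔄_k` below the top level are then vacuous.
[cite: Balaban1985Variational, p.302 («we take a unit cube Δ₀ ⊂ Bʲ(Λ_j) containing p or b»)] -/
theorem topFam_apply_top (S : Set (Site (F.P K) 0)) :
    (fun j => if K - n ≤ j then S else (∅ : Set (Site (F.P K) 0))) (K - n) = S := if_pos le_rfl

/-- Below the top level the one-set family is empty, so nothing touches it. [cite: Balaban1985Variational, p.302] -/
theorem topFam_apply_lt (S : Set (Site (F.P K) 0)) {j : ℕ} (hj : j < K - n) :
    (fun j => if K - n ≤ j then S else (∅ : Set (Site (F.P K) 0))) j = ∅ := if_neg (not_le.mpr hj)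

/-- The empty region pulls back to the empty set of `ℤᵈ`. [cite: Balaban1985RegularSpaces, (1.3) p.77] -/
theorem pullDom_empty (Ω : ℕ → Set (Site (F.P K) 0)) {j : ℕ} (hj : Ω j = ∅) : pullDom Ω j = ∅ := by
  ext y
  refine ⟨fun hy => ?_, fun hy => absurd hy (Set.notMem_empty _)⟩
  have h := (B8Thm2SetupTorus.mem_pullSet (Ω j) 0 y).mp hy
  rw [hj] at h
  exact h

/-- The pulled-back empty region has no `SideTouches` layer. [cite: Balaban1985RegularSpaces, p.77 (convention before (1.5))] -/
theorem not_sideTouches_pullDom_empty (Ω : ℕ → Set (Site (F.P K) 0)) {j : ℕ} (hj : Ω j = ∅)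
    (z : B7Prop1Explicit.Site (F.P K).d) (μ : Fin (F.P K).d) : ¬ SideTouches (pullDom Ω j) z μ := by
  rintro ⟨w, κ, ν, -, hp, -⟩
  rw [pullDom_empty F K Ω hj] at hp
  rcases hp with h | h | h | h <;> exact h

/-- (1.140) on the pulled-back empty region is vacuous. [cite: Balaban1985RegularSpaces, (1.140) p.100] -/
theorem cond140_pullDom_empty (Ω : ℕ → Set (Site (F.P K) 0)) {j : ℕ} (hj : Ω j = ∅) (η α₂ : ℝ)
    (U₀ : B7Prop1Explicit.Site (F.P K).d → Fin (F.P K).d → (Matrix (Fin 2) (Fin 2) ℂ)ˣ)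
    (A : B7Prop1Explicit.Site (F.P K).d → Fin (F.P K).d → Matrix (Fin 2) (Fin 2) ℂ) :
    Cond140 (F.P K).L η α₂ j (pullDom Ω j) U₀ A := by
  have hempty : pullDom Ω j = ∅ := pullDom_empty F K Ω hj
  refine ⟨fun y τ hy => absurd hy (not_sideTouches_pullDom_empty F K Ω hj y τ), fun y κ τ hy =>
    absurd hy (not_sideTouches_pullDom_empty F K Ω hj y τ), fun y μ hy => ?_⟩
  rw [hempty] at hy
  rcases hy with h | h <;> exact absurd h (Set.notMem_empty _)

/-- **(168) ⇒ (2) WITH ONE SET PER SITE** (the shape Sect. F produces: `S = Δ₀ = Bᵏ(y) ∋ x`, chart and (167)-bounds on the bonds around `S`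
only): if around every site `x` there are `S ∋ x`, `u`, `A` self-adjoint with `U^{u⁻¹} = e^{iηA}` on the `SideTouches` layer of `S♯` and (1.140)
at size `α₂` at the TOP level on `S♯`, then `U ∈ 𝔘_k(α₀ + 3α₂)`. [cite: Balaban1985Variational, (167)–(168) p.304] -/
theorem regPr_of_localCharts_top {α₀ α₂ : ℝ} (hα₀ : 0 < α₀) (hα₀c : α₀ ≤ 1 / 240) (hα₂ : 0 < α₂) (hα₂c : α₂ ≤ 1 / 240)
    (U : GaugeField (F.P K) 0 (Matrix.specialUnitaryGroup (Fin 2) ℂ))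
    (H : ∀ x : Site (F.P K) 0, ∃ (S : Set (Site (F.P K) 0)) (u : GaugeTransf (F.P K) 0 (Matrix.unitaryGroup (Fin 2) ℂ))
        (A : GaugeField (F.P K) 0 (Matrix (Fin 2) (Fin 2) ℂ)),
        x ∈ S ∧ (∀ b : PBond (F.P K) 0, IsSelfAdjoint (A b)) ∧
        (∀ (z : B7Prop1Explicit.Site (F.P K).d) (μ : Fin (F.P K).d),
          SideTouches (pullDom (fun j => if K - n ≤ j then S else (∅ : Set (Site (F.P K) 0))) (K - n)) z μ →
          mgauge (cfgPull (F.P K) 1) (gaugePull (F.P K) u)⁻¹ (cfgPull (F.P K) (toUField U)) z μ =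
            cfgExp (((F.L : ℝ)⁻¹) ^ (K - n)) (pull A 0) z μ) ∧
        Cond140 (F.P K).L (((F.L : ℝ)⁻¹) ^ (K - n)) α₂ (K - n)
          (pullDom (fun j => if K - n ≤ j then S else (∅ : Set (Site (F.P K) 0))) (K - n)) (cfgPull (F.P K) 1) (pull A 0)) :
    RegPr F n K (α₀ + 3 * α₂) U := by
  refine regPr_of_localCharts F n K hα₀ hα₀c hα₂ hα₂c U fun x => ?_
  obtain ⟨S, u, A, hx, hA, hchart, h140⟩ := H x
  refine ⟨fun j => if K - n ≤ j then S else ∅, u, A, ?_, hA, fun j hj z μ hz => ?_, fun j hj => ?_⟩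
  · show x ∈ (if K - n ≤ K - n then S else (∅ : Set (Site (F.P K) 0)))
    rw [if_pos le_rfl]; exact hx
  · rcases hj.lt_or_eq with hlt | rfl
    · exact absurd hz (not_sideTouches_pullDom_empty F K _ (topFam_apply_lt F n K S hlt) z μ)
    · exact hchart z μ hz
  · rcases hj.lt_or_eq with hlt | rfl
    · exact cond140_pullDom_empty F K _ (topFam_apply_lt F n K S hlt) _ _ _ _
    · exact h140

end LocalToGlobal

/-! ## §2 The arithmetic of (167)–(168) with F2's constants -/

/-- **THE ARITHMETIC OF THE FIRST CASE** with [B8] p40's constants (`3α₂` for print's `2ε′ + O(ε′²)`, thresholds `1/(80d) = 1/240`): for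
`m = max{B₃ε₁, ½ε₀}` in the regime `B₃ε₁ < ε₀`, `0 < ε₀ ≤ a₅`, `a₅ ≤ 1/90`, `24Ka₅ < 1`, `0 ≤ K`, and `e₁ = ¼m + Kε₀²` (print's (167) on `Δ₀`):
`α₀ := m − 3e₁` satisfies `0 < α₀ ≤ 1/240`, `0 < e₁ ≤ 1/240`, and `α₀ + 3e₁ = m`. [cite: Balaban1985Variational, (165)–(168) p.304] -/
theorem lastMile_arith {B₃ K a₅ ε₀ ε₁ : ℝ} (hB₃ : 0 < B₃) (hK : 0 ≤ K) (ha₅ : a₅ ≤ 1 / 90) (hKa : 24 * K * a₅ < 1)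
    (hε₁ : 0 < ε₁) (hε₀ : 0 < ε₀) (hε₀a : ε₀ ≤ a₅) (hreg : B₃ * ε₁ < ε₀) :
    0 < max (B₃ * ε₁) (ε₀ / 2) - 3 * (1 / 4 * max (B₃ * ε₁) (ε₀ / 2) + K * ε₀ ^ 2) ∧
      max (B₃ * ε₁) (ε₀ / 2) - 3 * (1 / 4 * max (B₃ * ε₁) (ε₀ / 2) + K * ε₀ ^ 2) ≤ 1 / 240 ∧
      0 < 1 / 4 * max (B₃ * ε₁) (ε₀ / 2) + K * ε₀ ^ 2 ∧
      1 / 4 * max (B₃ * ε₁) (ε₀ / 2) + K * ε₀ ^ 2 ≤ 1 / 240 ∧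
      max (B₃ * ε₁) (ε₀ / 2) - 3 * (1 / 4 * max (B₃ * ε₁) (ε₀ / 2) + K * ε₀ ^ 2) +
        3 * (1 / 4 * max (B₃ * ε₁) (ε₀ / 2) + K * ε₀ ^ 2) = max (B₃ * ε₁) (ε₀ / 2) := by
  set m : ℝ := max (B₃ * ε₁) (ε₀ / 2) with hm
  have hmε : m ≤ ε₀ := max_le hreg.le (by linarith)
  have hm2 : ε₀ / 2 ≤ m := le_max_right _ _
  have hm0 : 0 < m := lt_of_lt_of_le (by linarith) hm2
  have hKε : K * ε₀ ^ 2 ≤ K * a₅ * ε₀ := by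
    have : ε₀ ^ 2 ≤ a₅ * ε₀ := by nlinarith
    nlinarith
  have hKa' : 24 * (K * a₅ * ε₀) < ε₀ := by nlinarith
  have h12 : 12 * (K * ε₀ ^ 2) < m := by nlinarith
  have hK0 : 0 ≤ K * ε₀ ^ 2 := by positivity
  refine ⟨by nlinarith, ?_, by positivity, ?_, by ring⟩
  · -- α₀ ≤ m/4 ≤ ε₀/4 ≤ a₅/4 ≤ 1/360
    nlinarith
  · -- e₁ ≤ m/4 + m/12 = m/3 ≤ a₅/3 ≤ 1/270
    nlinarith

/-- An admissible `a₅ > 0` exists for every `K ≥ 0` below any given threshold `a > 0`: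
`a₅ := min a (min (1/90) (1/(24K + 24)))`. [cite: Balaban1985Variational, (166) p.304 («a largest absolute number a₅»)] -/
theorem exists_a5 {K a : ℝ} (hK : 0 ≤ K) (ha : 0 < a) :
    ∃ a₅ : ℝ, 0 < a₅ ∧ a₅ ≤ a ∧ a₅ ≤ 1 / 90 ∧ 24 * K * a₅ < 1 := by
  refine ⟨min a (min (1 / 90) (1 / (24 * K + 24))), lt_min ha (lt_min (by norm_num) (by positivity)), min_le_left _ _,
    (min_le_right _ _).trans (min_le_left _ _), ?_⟩
  have h1 : min a (min (1 / 90) (1 / (24 * K + 24))) ≤ 1 / (24 * K + 24) := (min_le_right _ _).trans (min_le_right _ _)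
  have h2 : 24 * K * (1 / (24 * K + 24)) < 1 := by
    rw [mul_one_div, div_lt_one (by positivity)]; linarith
  have h3 : 0 ≤ 24 * K := by positivity
  exact lt_of_le_of_lt (mul_le_mul_of_nonneg_left h1 h3) h2

/-! ## §3 The registered stub's text from the (167)-chart schema -/

section Halving

variable {L : ℕ} {B₃ K a a₅ : ℝ}

/-- **THE ONE-STEP HALVING FOR MINIMISERS ⇐ THE (167)-CHART SCHEMA.**  Hypothesis `H` (the located content of Sect. F (144)–(167) at the
carrier, NOT proved here): for every member `F` (`F.L = L`), heights `n < K`, `0 < ε₁`, `0 < ε₀ ≤ a`, in the regime `B₃ε₁ < ε₀`, every (7)-datum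
`V` and every minimiser `U` of the Wilson action over (6)(ε₀), around EVERY site `x` there is a local exponential chart (F2's letters) with
[6] (1.140)-bounds of size `¼max{B₃ε₁, ½ε₀} + Kε₀²` — print's (167) on `Δ₀ ∋ x`.  Conclusion: every such minimiser with `ε₀ ≤ a₅` lies in
`𝔘_k(max{B₃ε₁, ½ε₀})`, for any `a₅ ≤ a`, `a₅ ≤ 1/90`, `24Ka₅ < 1` — (168) by F2 and §1, the arithmetic of §2; the regime `ε₀ ≤ B₃ε₁` is the
monotonicity of (2). [cite: Balaban1985Variational, (167)–(168) p.304, Prop. 8 p.304] -/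
theorem halvingMinimisers_of_localCharts167 (hB₃ : 0 < B₃) (hK : 0 ≤ K) (ha₅a : a₅ ≤ a) (ha₅ : a₅ ≤ 1 / 90)
    (hKa : 24 * K * a₅ < 1)
    (H : ∀ F : T3Family, F.L = L → ∀ (n K' : ℕ) (hnK : n < K') (ε₀ ε₁ : ℝ), 0 < ε₁ → 0 < ε₀ → ε₀ ≤ a → B₃ * ε₁ < ε₀ →
      ∀ V : GaugeField (F.P n) 0 (Matrix.specialUnitaryGroup (Fin 2) ℂ), PlaqSmall ε₁ V →
        ∀ U ∈ regFibrePr F n K' hnK.le ε₀ V,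
          IsMinOn (fun W : GaugeField (F.P K') 0 (Matrix.specialUnitaryGroup (Fin 2) ℂ) => wilsonAction4 W) (regFibrePr F n K' hnK.le ε₀ V) U →
          ∀ x : Site (F.P K') 0, ∃ (Ω : ℕ → Set (Site (F.P K') 0)) (u : GaugeTransf (F.P K') 0 (Matrix.unitaryGroup (Fin 2) ℂ))
            (A : GaugeField (F.P K') 0 (Matrix (Fin 2) (Fin 2) ℂ)),
            x ∈ Ω (K' - n) ∧ (∀ b : PBond (F.P K') 0, IsSelfAdjoint (A b)) ∧
            (∀ j, j ≤ K' - n → ∀ (z : B7Prop1Explicit.Site (F.P K').d) (μ : Fin (F.P K').d), SideTouches (pullDom Ω j) z μ →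
              mgauge (cfgPull (F.P K') 1) (gaugePull (F.P K') u)⁻¹ (cfgPull (F.P K') (toUField U)) z μ =
                cfgExp (((F.L : ℝ)⁻¹) ^ (K' - n)) (pull A 0) z μ) ∧
            (∀ j, j ≤ K' - n → Cond140 (F.P K').L (((F.L : ℝ)⁻¹) ^ (K' - n)) (1 / 4 * max (B₃ * ε₁) (ε₀ / 2) + K * ε₀ ^ 2) j
              (pullDom Ω j) (cfgPull (F.P K') 1) (pull A 0))) :
    ∀ F : T3Family, F.L = L → ∀ (n K' : ℕ) (hnK : n < K') (ε₀ ε₁ : ℝ), 0 < ε₁ → 0 < ε₀ → ε₀ ≤ a₅ →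
      ∀ V : GaugeField (F.P n) 0 (Matrix.specialUnitaryGroup (Fin 2) ℂ), PlaqSmall ε₁ V →
        ∀ U ∈ regFibrePr F n K' hnK.le ε₀ V,
          IsMinOn (fun W : GaugeField (F.P K') 0 (Matrix.specialUnitaryGroup (Fin 2) ℂ) => wilsonAction4 W) (regFibrePr F n K' hnK.le ε₀ V) U →
            RegPr F n K' (max (B₃ * ε₁) (ε₀ / 2)) U := by
  intro F hF n K' hnK ε₀ ε₁ hε₁ hε₀ hε₀a V hV U hU hmin
  have hUreg : RegPr F n K' ε₀ U := ((mem_regFibrePr_iff F).mp hU).2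
  rcases le_or_gt ε₀ (B₃ * ε₁) with hcase | hcase
  · -- «If ½ε₀ ≦ B₃ε₁ …»: here even ε₀ ≤ B₃ε₁, monotonicity of the spaces (2)
    exact regPr_mono F (hcase.trans (le_max_left _ _)) hUreg
  · -- the first case proper: B₃ε₁ < ε₀ ≤ a₅
    obtain ⟨hα₀, hα₀c, he₁, he₁c, hsum⟩ := lastMile_arith hB₃ hK ha₅ hKa hε₁ hε₀ hε₀a hcase
    have h := regPr_of_localCharts F n K' hα₀ hα₀c he₁ he₁c U
      (H F hF n K' hnK ε₀ ε₁ hε₁ hε₀ (hε₀a.trans ha₅a) hcase V hV U hU hmin)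
    rwa [hsum] at h

/-- **THE LITERAL BODY OF v7's `stub_halvingStep` AT `(L, B₃, a₅)` ⇐ THE (167)-CHART SCHEMA** (through p1 g14's
`Prop8Iter.halvingLiteral_of_minimisers`): for every member `i : Idx L`, `0 < ε₁`, (7)-datum `V`, `U ∈ 𝔘_k(ε₀) ∩ 𝔅_k(V)` critical in reading R2,
`ε₀ ≤ a₅` ⇒ `U ∈ 𝔘_k(max{B₃ε₁, ½ε₀})`.  With `exists_a5` this is the registered stub modulo the schema:
`stub_halvingStep ⇐ ∀ L, 1 < L → ∃ B₃ > 4, ∃ K ≥ 0, ∃ a > 0, H(L, B₃, K, a)`. [cite: Balaban1985Variational, Sect. F p.304 before Prop. 8] -/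
theorem halvingLiteral_of_localCharts167 (hB₃ : 0 < B₃) (hK : 0 ≤ K) (ha₅a : a₅ ≤ a) (ha₅ : a₅ ≤ 1 / 90)
    (hKa : 24 * K * a₅ < 1)
    (H : ∀ F : T3Family, F.L = L → ∀ (n K' : ℕ) (hnK : n < K') (ε₀ ε₁ : ℝ), 0 < ε₁ → 0 < ε₀ → ε₀ ≤ a → B₃ * ε₁ < ε₀ →
      ∀ V : GaugeField (F.P n) 0 (Matrix.specialUnitaryGroup (Fin 2) ℂ), PlaqSmall ε₁ V →
        ∀ U ∈ regFibrePr F n K' hnK.le ε₀ V,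
          IsMinOn (fun W : GaugeField (F.P K') 0 (Matrix.specialUnitaryGroup (Fin 2) ℂ) => wilsonAction4 W) (regFibrePr F n K' hnK.le ε₀ V) U →
          ∀ x : Site (F.P K') 0, ∃ (Ω : ℕ → Set (Site (F.P K') 0)) (u : GaugeTransf (F.P K') 0 (Matrix.unitaryGroup (Fin 2) ℂ))
            (A : GaugeField (F.P K') 0 (Matrix (Fin 2) (Fin 2) ℂ)),
            x ∈ Ω (K' - n) ∧ (∀ b : PBond (F.P K') 0, IsSelfAdjoint (A b)) ∧
            (∀ j, j ≤ K' - n → ∀ (z : B7Prop1Explicit.Site (F.P K').d) (μ : Fin (F.P K').d), SideTouches (pullDom Ω j) z μ →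
              mgauge (cfgPull (F.P K') 1) (gaugePull (F.P K') u)⁻¹ (cfgPull (F.P K') (toUField U)) z μ =
                cfgExp (((F.L : ℝ)⁻¹) ^ (K' - n)) (pull A 0) z μ) ∧
            (∀ j, j ≤ K' - n → Cond140 (F.P K').L (((F.L : ℝ)⁻¹) ^ (K' - n)) (1 / 4 * max (B₃ * ε₁) (ε₀ / 2) + K * ε₀ ^ 2) j
              (pullDom Ω j) (cfgPull (F.P K') 1) (pull A 0))) :
    ∀ (i : Idx L) (ε₀ ε₁ : ℝ), 0 < ε₁ → ∀ (V : (famX L i).Bdry) (U : (famX L i).Cfg), (famX L i).Reg7 ε₁ V → (famX L i).InU ε₀ U →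
      (famX L i).InB V U → (famX L i).IsCritical V U → ε₀ ≤ a₅ → (famX L i).InU (max (B₃ * ε₁) (ε₀ / 2)) U :=
  Prop8Iter.halvingLiteral_of_minimisers (halvingMinimisers_of_localCharts167 hB₃ hK ha₅a ha₅ hKa H)

end Halving

/-! ## §4 The registered stub's full text from the schema family (v1.1, append-only) -/

section StubShape

open Literature.MathematicalPhysics.QuantumFieldTheory.Balaban1983to89.B11 (Prop8Printed)

/-- **v7's `stub_halvingStep`, FULL TEXT, ⇐ THE (167)-CHART SCHEMA FAMILY**: if for every block size `L > 1` there are `B₃ > 4`, `K ≥ 0`, `a > 0`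
with the (167)-chart schema `H(L, B₃, K, a)` of §3, then the REGISTERED statement of skeleton v7 holds verbatim
(`∀ L, 1 < L → ∃ B₃, 4 < B₃ ∧ ∃ a₅, 0 < a₅ ∧ …`; `a₅` from `exists_a5`).  A future skeleton may write
`stub_halvingStep := Prop8LastMile.stubText_of_localCharts167 ‹schema›`. [cite: Balaban1985Variational, Sect. F p.304 before Prop. 8] -/
theorem stubText_of_localCharts167
    (H : ∀ L : ℕ, 1 < L → ∃ B₃ : ℝ, 4 < B₃ ∧ ∃ K : ℝ, 0 ≤ K ∧ ∃ a : ℝ, 0 < a ∧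
      ∀ F : T3Family, F.L = L → ∀ (n K' : ℕ) (hnK : n < K') (ε₀ ε₁ : ℝ), 0 < ε₁ → 0 < ε₀ → ε₀ ≤ a → B₃ * ε₁ < ε₀ →
        ∀ V : GaugeField (F.P n) 0 (Matrix.specialUnitaryGroup (Fin 2) ℂ), PlaqSmall ε₁ V →
          ∀ U ∈ regFibrePr F n K' hnK.le ε₀ V,
            IsMinOn (fun W : GaugeField (F.P K') 0 (Matrix.specialUnitaryGroup (Fin 2) ℂ) => wilsonAction4 W) (regFibrePr F n K' hnK.le ε₀ V) U →
            ∀ x : Site (F.P K') 0, ∃ (Ω : ℕ → Set (Site (F.P K') 0)) (u : GaugeTransf (F.P K') 0 (Matrix.unitaryGroup (Fin 2) ℂ))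
              (A : GaugeField (F.P K') 0 (Matrix (Fin 2) (Fin 2) ℂ)),
              x ∈ Ω (K' - n) ∧ (∀ b : PBond (F.P K') 0, IsSelfAdjoint (A b)) ∧
              (∀ j, j ≤ K' - n → ∀ (z : B7Prop1Explicit.Site (F.P K').d) (μ : Fin (F.P K').d), SideTouches (pullDom Ω j) z μ →
                mgauge (cfgPull (F.P K') 1) (gaugePull (F.P K') u)⁻¹ (cfgPull (F.P K') (toUField U)) z μ =
                  cfgExp (((F.L : ℝ)⁻¹) ^ (K' - n)) (pull A 0) z μ) ∧
              (∀ j, j ≤ K' - n → Cond140 (F.P K').L (((F.L : ℝ)⁻¹) ^ (K' - n)) (1 / 4 * max (B₃ * ε₁) (ε₀ / 2) + K * ε₀ ^ 2) j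
                (pullDom Ω j) (cfgPull (F.P K') 1) (pull A 0))) :
    ∀ (L : ℕ), 1 < L → ∃ B₃ : ℝ, 4 < B₃ ∧ ∃ a₅ : ℝ, 0 < a₅ ∧
      ∀ (i : Idx L) (ε₀ ε₁ : ℝ), 0 < ε₁ → ∀ (V : (famX L i).Bdry) (U : (famX L i).Cfg), (famX L i).Reg7 ε₁ V → (famX L i).InU ε₀ U →
        (famX L i).InB V U → (famX L i).IsCritical V U → ε₀ ≤ a₅ → (famX L i).InU (max (B₃ * ε₁) (ε₀ / 2)) U := by
  intro L hL
  obtain ⟨B₃, hB₃, K, hK, a, ha, h⟩ := H L hL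
  obtain ⟨a₅, ha₅, ha₅a, ha₅', hKa⟩ := exists_a5 hK ha
  exact ⟨B₃, hB₃, a₅, ha₅, halvingLiteral_of_localCharts167 (by linarith) hK ha₅a ha₅' hKa h⟩

/-- **PROPOSITION 8 AT THE CARRIERS ⇐ THE (167)-CHART SCHEMA FAMILY** (v7's `landed_prop8` line through p1 g14's iteration
`Prop8Iter.prop8_of_halvingLiteral`, same `B₃`). [cite: Balaban1985Variational, Prop. 8 p.304] -/
theorem prop8_of_localCharts167
    (H : ∀ L : ℕ, 1 < L → ∃ B₃ : ℝ, 4 < B₃ ∧ ∃ K : ℝ, 0 ≤ K ∧ ∃ a : ℝ, 0 < a ∧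
      ∀ F : T3Family, F.L = L → ∀ (n K' : ℕ) (hnK : n < K') (ε₀ ε₁ : ℝ), 0 < ε₁ → 0 < ε₀ → ε₀ ≤ a → B₃ * ε₁ < ε₀ →
        ∀ V : GaugeField (F.P n) 0 (Matrix.specialUnitaryGroup (Fin 2) ℂ), PlaqSmall ε₁ V →
          ∀ U ∈ regFibrePr F n K' hnK.le ε₀ V,
            IsMinOn (fun W : GaugeField (F.P K') 0 (Matrix.specialUnitaryGroup (Fin 2) ℂ) => wilsonAction4 W) (regFibrePr F n K' hnK.le ε₀ V) U →
            ∀ x : Site (F.P K') 0, ∃ (Ω : ℕ → Set (Site (F.P K') 0)) (u : GaugeTransf (F.P K') 0 (Matrix.unitaryGroup (Fin 2) ℂ))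
              (A : GaugeField (F.P K') 0 (Matrix (Fin 2) (Fin 2) ℂ)),
              x ∈ Ω (K' - n) ∧ (∀ b : PBond (F.P K') 0, IsSelfAdjoint (A b)) ∧
              (∀ j, j ≤ K' - n → ∀ (z : B7Prop1Explicit.Site (F.P K').d) (μ : Fin (F.P K').d), SideTouches (pullDom Ω j) z μ →
                mgauge (cfgPull (F.P K') 1) (gaugePull (F.P K') u)⁻¹ (cfgPull (F.P K') (toUField U)) z μ =
                  cfgExp (((F.L : ℝ)⁻¹) ^ (K' - n)) (pull A 0) z μ) ∧
              (∀ j, j ≤ K' - n → Cond140 (F.P K').L (((F.L : ℝ)⁻¹) ^ (K' - n)) (1 / 4 * max (B₃ * ε₁) (ε₀ / 2) + K * ε₀ ^ 2) j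
                (pullDom Ω j) (cfgPull (F.P K') 1) (pull A 0))) :
    ∀ L : ℕ, 1 < L → ∃ B₃ : ℝ, 4 < B₃ ∧ Prop8Printed B₃ (famX L) :=
  Prop8Iter.prop8_of_halvingLiteral (stubText_of_localCharts167 H)

end StubShape

end Summit.QuantumFields.YangMills.Theorems.Prop8LastMile

end
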